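import Summits.Ventures.PercRepro2.CaseOnePendantAnyI
import Summits.Ventures.PercRepro2.CaseOneStarMainI
import Summits.Ventures.PercRepro2.CaseOneStarMainQt
import Summits.Ventures.PercRepro2.CaseOneStarAggQtI

/-!
# The marked star: `(i-Q)` for every `a₃` adjacent exactly to `a₁, a₂, o, b`
(blind cell PercRepro2, p1 g16; S5 §2.1 (K9) (q): the `a1ᴵ(u)` row of the `(i)`-side pendant lemma)

`iExprT_eq_iQt4`: the `(i)`-side Q-threshold form `iExprT (Dqo) (P(Q))` is the polynomial `iQt4` at the
edge weights and the cell masses of the pinned law (the `B₁`-masses of `CaseOneStarMainI.lean`, `mass_YU`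
and `smYU_mix` of the `(ii)`-side), and `iQt4_nonneg` (CaseOneStarAggQtI.lean) gives
**`zSplitIQ_of_markedStar`**: `(i-Q)` for every finite graph, every weight vector, every `a₃` whose edges
are exactly the four edges to `a₁, a₂, o, b`. With `zSplitI_of_markedStar` and K8 (`zSplitI_of_leaf_at`)
this closes `(i)` — and with the `(ii)`-side `(J1₁)` — for every pendant vertex at such an `a₃`
(CaseOneStarPendant.lean). -/

namespace Summit.Ventures.PercRepro2

namespace CaseOne

section ClosedQtI
variable {V : Type*} {E : Type*} [Fintype E] [DecidableEq E] [Fintype V] [DecidableEq V]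
  {R : Type*} [Field R] [LinearOrder R] [IsStrictOrderedRing R]
variable {ends : E → Sym2 V} {o a₁ a₂ b a₃ : V} {e₁ e₂ eo eb : E}

omit [Fintype V] [DecidableEq V] [LinearOrder R] [IsStrictOrderedRing R] in
/-- **The `(i)`-side Q-threshold form is `iQt4`** at the four edge weights and the cell masses of the pinned law. -/
theorem iExprT_eq_iQt4 (p : E → R) (h : IsMarkedStarAt ends o a₁ a₂ b a₃ e₁ e₂ eo eb) :
    iExprT p ends o a₁ a₂ a₃ b (Dqo p ends o a₁ a₂) (prob p (connEvent ends a₁ a₂)ᶜ) =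
      iQt4 (p e₁) (p e₂) (p eo) (p eb) (scells (pin4 p e₁ e₂ eo eb) ends o a₁ a₂ b) := by
  rw [iExprT_eq, mass_Q p h, mass_QA p h, mass_QAO p h, mass_QB1 p h, mass_QAB1 p h, mass_QAB1O p h,
    mass_YU p h, ← smQ_mix p e₁ e₂ eo eb, ← smQA_mix p e₁ e₂ eo eb, ← smQAO_mix p e₁ e₂ eo eb,
    ← smQB1_mix p e₁ e₂ eo eb, ← smQAB1_mix p e₁ e₂ eo eb, ← smQAB1O_mix p e₁ e₂ eo eb,
    ← smYU_mix p e₁ e₂ eo eb]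
  rfl

/-- **`(i-Q)` for every `a₃` adjacent exactly to `a₁`, `a₂`, `o` and `b`, every finite graph, every
weight vector** — the `(i)`-side small-weight pendant inequality `a1ᴵ(a₃) ≥ 0` of the pendant lemma. -/
theorem zSplitIQ_of_markedStar (p : E → R) (hp : IsProbVec p)
    (h : IsMarkedStarAt ends o a₁ a₂ b a₃ e₁ e₂ eo eb) : ZSplitIQ p ends o a₁ a₂ a₃ b := by
  unfold ZSplitIQ
  rw [iExprT_eq_iQt4 p h]
  have hp0 : IsProbVec (pin4 p e₁ e₂ eo eb) :=
    (((hp.update e₁ le_rfl zero_le_one).update e₂ le_rfl zero_le_one).update eo le_rfl zero_le_one).update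
      eb le_rfl zero_le_one
  exact iQt4_nonneg _ _ _ _ _ (sFacts (pin4 p e₁ e₂ eo eb) hp0) (hp.nonneg e₁) (hp.le_one e₁)
    (hp.nonneg e₂) (hp.le_one e₂) (hp.nonneg eo) (hp.le_one eo) (hp.nonneg eb) (hp.le_one eb)

end ClosedQtI

end CaseOne

end Summit.Ventures.PercRepro2
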